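import Mathlib
import Summits.ValiantsHypothesis.ValiantsHypothesis.Theses.NewtonUnitEquations
import Summits.ValiantsHypothesis.ValiantsHypothesis.Theorems.DissociatedFixedK.Negative.LoadBearing
import Summits.ValiantsHypothesis.ValiantsHypothesis.Theorems.NewtonUnitEquationsDissociatedFixedKExposedWord

/-!
# `DissociatedFixedK` (stmt-ValiantsHypothesis-5907), negative lane: vertex certificates for binomial pencils

Part 1 of 3 of the `k = 2` exponent lower bound (standing disprover, gen 2; parts: `PencilCert`,
`HyperbolaFamily`, `KTwoExponent`).  Generic, reusable machinery for BINOMIAL-PENCIL frames (`t = 2`: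
`A j = {0, d_j}`, two products of binomials `u_ij + v_ij X^{d_j}` with integer coefficients `u v`):
the dictionary subset `S ↦ word ↦ exponent Σ_{j∈S} d_j` (`dvec/frame/fac/ss/tval/word`), dissociation from
injectivity of the integer subset-sum map `ss` (`frame_dissociated`; `ss_injective_of_card` is the
`decide`-able form), the coefficient-is-tensor-value formula through the landed
`coeff_sum_prod_of_dissociated` (`tensor_word`), and the VERTEX CERTIFICATE `vertex_of_cert`: if an integer
functional `w` puts every other surviving subset strictly below `S₀`, the point of `S₀` is an extreme point of
the Newton polygon (`mem_extremePoints_convexHull_of_strict_sep`); `card_le_vertices` / `length_le_vertices`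
count certified vertices.  Plus three abstract separation lemmas for additive set functions
(`sum_lt_sum_filter_pos`, `sum_lt_of_neg`, `sum_lt_sum_erase_of_pos`) used by the family in part 2.
-/

namespace Summit.ValiantsHypothesis.ValiantsHypothesis.Theorems.DissociatedFixedK.Negative

open Finset MvPolynomial
open Summit.ValiantsHypothesis.Theorems.DissociatedFixedK (coeff_sum_prod_of_dissociated
  exists_word_of_mem_support)

section Pencil

variable {m : ℕ} (gen : Fin m → ℕ × ℕ) (u v : Fin 2 → Fin m → ℤ)

/-- Generator `j` as an exponent vector `(x_j, y_j) ∈ ℕ²`. -/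
noncomputable def dvec (j : Fin m) : Fin 2 →₀ ℕ :=
  Finsupp.equivFunOnFinite.symm ![(gen j).1, (gen j).2]

/-- First coordinate of the generator vector. -/
@[simp] theorem dvec_apply_zero (j : Fin m) : dvec gen j 0 = (gen j).1 := by
  simp [dvec]

/-- Second coordinate of the generator vector. -/
@[simp] theorem dvec_apply_one (j : Fin m) : dvec gen j 1 = (gen j).2 := by
  simp [dvec]

/-- The binomial frame `A j = {0, d_j}`. -/
noncomputable def frame (j : Fin m) : Finset (Fin 2 →₀ ℕ) := {0, dvec gen j}

/-- The binomial frame has at most two letters per factor (`t = 2`). -/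
theorem card_frame_le (j : Fin m) : (frame gen j).card ≤ 2 := Finset.card_le_two

/-- Factor `j` of product `i`: `u_ij + v_ij X^{d_j}` (integer coefficients). -/
noncomputable def fac (i : Fin 2) (j : Fin m) : MvPolynomial (Fin 2) ℂ :=
  monomial 0 ((u i j : ℤ) : ℂ) + monomial (dvec gen j) ((v i j : ℤ) : ℂ)

/-- Each factor is supported on its frame `{0, d_j}`. -/
theorem support_fac_subset (i : Fin 2) (j : Fin m) : (fac gen u v i j).support ⊆ frame gen j := by
  intro e he
  rcases Finset.mem_union.mp (support_add he) with h | h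
  · have := support_monomial_subset h
    rw [Finset.mem_singleton] at this
    simp [frame, this]
  · have := support_monomial_subset h
    rw [Finset.mem_singleton] at this
    simp [frame, this]

/-- Integer subset-sum coordinates of a subset of generators. -/
def ss (S : Finset (Fin m)) : ℤ × ℤ := (∑ j ∈ S, ((gen j).1 : ℤ), ∑ j ∈ S, ((gen j).2 : ℤ))

/-- Integer pairing. -/
def dot (w p : ℤ × ℤ) : ℤ := w.1 * p.1 + w.2 * p.2

/-- The rank-2 tensor value at the word of `S`: `Σ_i Π_j (v_ij if j ∈ S else u_ij)`. -/
def tval (S : Finset (Fin m)) : ℤ := ∑ i, ∏ j, (if j ∈ S then v i j else u i j)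

/-- The frame word of a subset: letter `d_j` on `S`, letter `0` off `S`. -/
noncomputable def word (S : Finset (Fin m)) : Fin m → (Fin 2 →₀ ℕ) :=
  fun j => if j ∈ S then dvec gen j else 0

/-- The word of a subset lies in the frame. -/
theorem word_mem (S : Finset (Fin m)) (j : Fin m) : word gen S j ∈ frame gen j := by
  by_cases h : j ∈ S <;> simp [word, frame, h]

/-- The exponent of the word of `S` is the subset sum `Σ_{j∈S} d_j`. -/
theorem sum_word (S : Finset (Fin m)) : ∑ j, word gen S j = ∑ j ∈ S, dvec gen j := by
  simp only [word]
  rw [Finset.sum_ite_mem, Finset.univ_inter]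

/-- Every frame word is the word of a subset. -/
theorem exists_subset_of_word (a : Fin m → (Fin 2 →₀ ℕ)) (ha : ∀ j, a j ∈ frame gen j) :
    ∃ S : Finset (Fin m), a = word gen S := by
  classical
  refine ⟨Finset.univ.filter (fun j => a j = dvec gen j), ?_⟩
  funext j
  have hj := ha j
  simp only [frame, Finset.mem_insert, Finset.mem_singleton] at hj
  by_cases h : a j = dvec gen j
  · have hmem : j ∈ Finset.univ.filter (fun j => a j = dvec gen j) :=
      Finset.mem_filter.mpr ⟨Finset.mem_univ _, h⟩
    rw [word, if_pos hmem, h]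
  · have hnot : j ∉ Finset.univ.filter (fun j => a j = dvec gen j) := fun hm =>
      h (Finset.mem_filter.mp hm).2
    rw [word, if_neg hnot]
    rcases hj with h0 | h1
    · exact h0
    · exact absurd h1 h

/-- First coordinate of a subset sum of generators. -/
theorem dsum_apply_zero (S : Finset (Fin m)) :
    ((∑ j ∈ S, dvec gen j) 0 : ℕ) = ∑ j ∈ S, (gen j).1 := by
  rw [Finsupp.finsetSum_apply]
  simp

/-- Second coordinate of a subset sum of generators. -/
theorem dsum_apply_one (S : Finset (Fin m)) :
    ((∑ j ∈ S, dvec gen j) 1 : ℕ) = ∑ j ∈ S, (gen j).2 := by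
  rw [Finsupp.finsetSum_apply]
  simp

/-- Distinct subset sums (checked by a cardinality computation) make `ss` injective. -/
theorem ss_injective_of_card (hcard : ((Finset.univ : Finset (Fin m)).powerset.image (ss gen)).card = 2 ^ m) :
    Function.Injective (ss gen) := by
  have h : ((Finset.univ : Finset (Fin m)).powerset.image (ss gen)).card =
      (Finset.univ : Finset (Fin m)).powerset.card := by
    rw [hcard, Finset.card_powerset, Finset.card_univ, Fintype.card_fin]
  have hinj := Finset.card_image_iff.mp h
  intro S S' hSS'
  exact hinj (by simp) (by simp) hSS'

/-- Injectivity of `ss` gives injectivity of the exponent subset sums. -/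
theorem dsum_injective (hss : Function.Injective (ss gen))
    (S S' : Finset (Fin m)) (h : ∑ j ∈ S, dvec gen j = ∑ j ∈ S', dvec gen j) : S = S' := by
  apply hss
  have h0 := congrArg (fun e => ((e 0 : ℕ) : ℤ)) h
  have h1 := congrArg (fun e => ((e 1 : ℕ) : ℤ)) h
  simp only [dsum_apply_zero, dsum_apply_one] at h0 h1
  push_cast at h0 h1
  exact Prod.ext h0 h1

/-- The binomial frame is dissociated once the subset sums are distinct. -/
theorem frame_dissociated (hss : Function.Injective (ss gen)) :
    ∀ a b : Fin m → (Fin 2 →₀ ℕ), (∀ j, a j ∈ frame gen j) → (∀ j, b j ∈ frame gen j) →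
      ∑ j, a j = ∑ j, b j → a = b := by
  intro a b ha hb hab
  obtain ⟨S, rfl⟩ := exists_subset_of_word gen a ha
  obtain ⟨S', rfl⟩ := exists_subset_of_word gen b hb
  rw [sum_word, sum_word] at hab
  rw [dsum_injective gen hss S S' hab]

/-- Nonzero generators give nonzero exponent vectors. -/
theorem dvec_ne_zero (hgen : ∀ j, gen j ≠ (0, 0)) (j : Fin m) : dvec gen j ≠ 0 := by
  intro h
  apply hgen j
  have h0 := congrArg (fun e => e 0) h
  have h1 := congrArg (fun e => e 1) h
  simp only [dvec_apply_zero, dvec_apply_one, Finsupp.coe_zero, Pi.zero_apply] at h0 h1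
  exact Prod.ext h0 h1

/-- Coefficients of the factors at the frame letters. -/
theorem coeff_fac_word (hgen : ∀ j, gen j ≠ (0, 0)) (i : Fin 2) (S : Finset (Fin m)) (j : Fin m) :
    coeff (word gen S j) (fac gen u v i j) = (((if j ∈ S then v i j else u i j) : ℤ) : ℂ) := by
  have hne := dvec_ne_zero gen hgen j
  by_cases h : j ∈ S
  · rw [word, if_pos h, fac, coeff_add, coeff_monomial, coeff_monomial, if_neg hne.symm, if_pos rfl,
      if_pos h, zero_add]
  · rw [word, if_neg h, fac, coeff_add, coeff_monomial, coeff_monomial, if_pos rfl, if_neg hne,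
      if_neg h, add_zero]

/-- The complex tensor value at the word of `S` is the integer `tval S`. -/
theorem tensor_word (hgen : ∀ j, gen j ≠ (0, 0)) (S : Finset (Fin m)) :
    (∑ i, ∏ j, coeff (word gen S j) (fac gen u v i j)) = ((tval u v S : ℤ) : ℂ) := by
  simp only [coeff_fac_word gen u v hgen, tval]
  push_cast
  rfl

/-- The linear functional `(X, Y) ↦ w₁ X + w₂ Y` on `ℝ²`. -/
noncomputable def lfun (w : ℤ × ℤ) : (Fin 2 → ℝ) →ₗ[ℝ] ℝ :=
  (w.1 : ℝ) • LinearMap.proj 0 + (w.2 : ℝ) • LinearMap.proj 1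

/-- The functional `lfun w` evaluates on the point of `S` to the integer pairing `dot w (ss S)`. -/
theorem lfun_emb_dsum (w : ℤ × ℤ) (S : Finset (Fin m)) :
    lfun w (emb (∑ j ∈ S, dvec gen j)) = ((dot w (ss gen S) : ℤ) : ℝ) := by
  simp only [lfun, LinearMap.add_apply, LinearMap.smul_apply, LinearMap.proj_apply, emb,
    dsum_apply_zero, dsum_apply_one, dot, ss, smul_eq_mul]
  push_cast
  ring

/-- **Vertex certificate.**  If `tval S₀ ≠ 0` and an integer functional `w` puts every OTHER surviving
subset strictly below `S₀`, then the point of `S₀` is a vertex of the Newton polygon. -/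
theorem vertex_of_cert (hgen : ∀ j, gen j ≠ (0, 0)) (hss : Function.Injective (ss gen))
    (S₀ : Finset (Fin m)) (w : ℤ × ℤ) (hT : tval u v S₀ ≠ 0)
    (hsep : ∀ S, S ≠ S₀ → tval u v S ≠ 0 → dot w (ss gen S) < dot w (ss gen S₀)) :
    emb (∑ j ∈ S₀, dvec gen j) ∈ Set.extremePoints ℝ (convexHull ℝ
      (emb '' ((∑ i, ∏ j, fac gen u v i j).support : Set (Fin 2 →₀ ℕ)))) := by
  have hsupp := support_fac_subset gen u v
  have hinj := frame_dissociated gen hss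
  refine mem_extremePoints_convexHull_of_strict_sep ?_ (lfun w) ?_
  · refine ⟨∑ j ∈ S₀, dvec gen j, ?_, rfl⟩
    rw [Finset.mem_coe, mem_support_iff, ← sum_word,
      coeff_sum_prod_of_dissociated (frame gen) (fac gen u v) hsupp hinj (word gen S₀) (word_mem gen S₀),
      tensor_word gen u v hgen]
    exact_mod_cast hT
  · rintro y ⟨e, he, rfl⟩ hne
    obtain ⟨a, ha, hae, hTa⟩ := exists_word_of_mem_support (frame gen) (fac gen u v) hsupp hinj he
    obtain ⟨S, rfl⟩ := exists_subset_of_word gen a ha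
    rw [sum_word] at hae
    subst hae
    rw [tensor_word gen u v hgen] at hTa
    have hTS : tval u v S ≠ 0 := by exact_mod_cast hTa
    have hS : S ≠ S₀ := by
      rintro rfl
      exact hne rfl
    have := hsep S hS hTS
    rw [lfun_emb_dsum, lfun_emb_dsum]
    exact_mod_cast this

/-- **Counting certified vertices.**  Distinct certified subsets give distinct vertices, so a finset
`Cs` of certified subsets bounds the vertex count from below. -/
theorem card_le_vertices (hgen : ∀ j, gen j ≠ (0, 0)) (hss : Function.Injective (ss gen))
    (Cs : Finset (Finset (Fin m)))
    (hCs : ∀ S₀ ∈ Cs, tval u v S₀ ≠ 0 ∧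
      ∃ w : ℤ × ℤ, ∀ S, S ≠ S₀ → tval u v S ≠ 0 → dot w (ss gen S) < dot w (ss gen S₀)) :
    Cs.card ≤ (Set.extremePoints ℝ (convexHull ℝ
      (emb '' ((∑ i, ∏ j, fac gen u v i j).support : Set (Fin 2 →₀ ℕ))))).ncard := by
  classical
  set EP := Set.extremePoints ℝ (convexHull ℝ
      (emb '' ((∑ i, ∏ j, fac gen u v i j).support : Set (Fin 2 →₀ ℕ)))) with hEP
  let pt : Finset (Fin m) → (Fin 2 → ℝ) := fun S => emb (∑ j ∈ S, dvec gen j)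
  have hpt_inj : Function.Injective pt := by
    intro S S' h
    exact dsum_injective gen hss S S' (emb_injective h)
  have hfin : EP.Finite := by
    refine Set.Finite.subset (Set.Finite.image emb
      ((∑ i, ∏ j, fac gen u v i j).support).finite_toSet) ?_
    exact extremePoints_convexHull_subset
  have hsub : ((Cs.image pt : Finset (Fin 2 → ℝ)) : Set (Fin 2 → ℝ)) ⊆ EP := by
    intro p hp
    rw [Finset.mem_coe, Finset.mem_image] at hp
    obtain ⟨S, hS, rfl⟩ := hp
    obtain ⟨hT, w, hsep⟩ := hCs S hS
    exact vertex_of_cert gen u v hgen hss S w hT hsep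
  calc Cs.card = (Cs.image pt).card := (Finset.card_image_of_injective _ hpt_inj).symm
    _ = ((Cs.image pt : Finset (Fin 2 → ℝ)) : Set (Fin 2 → ℝ)).ncard := (Set.ncard_coe_finset _).symm
    _ ≤ EP.ncard := Set.ncard_le_ncard hsub hfin

/-- List form for `decide`d instances: certificates `(S₀, w)` with pairwise distinct `S₀`. -/
theorem length_le_vertices (hgen : ∀ j, gen j ≠ (0, 0)) (hss : Function.Injective (ss gen))
    (certs : List (Finset (Fin m) × (ℤ × ℤ)))
    (hcerts : ∀ c ∈ certs, tval u v c.1 ≠ 0 ∧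
      ∀ S ∈ (Finset.univ : Finset (Fin m)).powerset, S ≠ c.1 → tval u v S ≠ 0 →
        dot c.2 (ss gen S) < dot c.2 (ss gen c.1))
    (hnodup : (certs.map Prod.fst).Nodup) :
    certs.length ≤ (Set.extremePoints ℝ (convexHull ℝ
      (emb '' ((∑ i, ∏ j, fac gen u v i j).support : Set (Fin 2 →₀ ℕ))))).ncard := by
  classical
  have h := card_le_vertices gen u v hgen hss (certs.map Prod.fst).toFinset (by
    intro S₀ hS₀
    rw [List.mem_toFinset, List.mem_map] at hS₀
    obtain ⟨c, hc, rfl⟩ := hS₀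
    obtain ⟨hT, hsep⟩ := hcerts c hc
    exact ⟨hT, c.2, fun S hS hTS => hsep S (by simp) hS hTS⟩)
  calc certs.length = (certs.map Prod.fst).length := by simp
    _ = (certs.map Prod.fst).toFinset.card := (List.toFinset_card_of_nodup hnodup).symm
    _ ≤ _ := h

end Pencil

/-! ## Three abstract separation lemmas for additive set functions -/

section SetFun

variable {ι : Type*} [Fintype ι] [DecidableEq ι] (g : ι → ℤ)

/-- If `g` never vanishes, its positivity set is the unique strict maximiser of `S ↦ Σ_S g`. -/
theorem sum_lt_sum_filter_pos (hg : ∀ i, g i ≠ 0) (S : Finset ι)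
    (hS : S ≠ Finset.univ.filter (fun i => 0 < g i)) :
    ∑ i ∈ S, g i < ∑ i ∈ Finset.univ.filter (fun i => 0 < g i), g i := by
  set P := Finset.univ.filter (fun i => 0 < g i) with hP
  have hmemP : ∀ i, i ∈ P ↔ 0 < g i := fun i => by simp [hP]
  have h1 : ∑ i ∈ S ∩ P, g i + ∑ i ∈ S \ P, g i = ∑ i ∈ S, g i := Finset.sum_inter_add_sum_sdiff S P g
  have h2 : ∑ i ∈ P ∩ S, g i + ∑ i ∈ P \ S, g i = ∑ i ∈ P, g i := Finset.sum_inter_add_sum_sdiff P S g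
  have hneg : ∑ i ∈ S \ P, g i ≤ 0 := by
    refine Finset.sum_nonpos (fun i hi => ?_)
    have : i ∉ P := (Finset.mem_sdiff.mp hi).2
    rw [hmemP] at this
    omega
  have hpos : 0 ≤ ∑ i ∈ P \ S, g i := by
    refine Finset.sum_nonneg (fun i hi => ?_)
    have : i ∈ P := (Finset.mem_sdiff.mp hi).1
    rw [hmemP] at this
    omega
  have hcomm : S ∩ P = P ∩ S := Finset.inter_comm S P
  -- one of the two differences is nonempty
  have hne : (S \ P).Nonempty ∨ (P \ S).Nonempty := by
    by_contra h
    simp only [not_or, Finset.not_nonempty_iff_eq_empty, Finset.sdiff_eq_empty_iff_subset] at h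
    exact hS (Finset.Subset.antisymm h.1 h.2)
  rcases hne with h | h
  · have hneg' : ∑ i ∈ S \ P, g i < 0 := by
      refine Finset.sum_neg (fun i hi => ?_) h
      have hi' : i ∉ P := (Finset.mem_sdiff.mp hi).2
      rw [hmemP] at hi'
      have := hg i
      omega
    rw [hcomm] at h1
    omega
  · have hpos' : 0 < ∑ i ∈ P \ S, g i := by
      refine Finset.sum_pos (fun i hi => ?_) h
      have hi' : i ∈ P := (Finset.mem_sdiff.mp hi).1
      exact (hmemP i).mp hi'
    rw [hcomm] at h1
    omega

omit [Fintype ι] in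
/-- If `g < 0` everywhere with a strict unique maximum at `j`, then `{j}` is the unique strict
maximiser of `S ↦ Σ_S g` among NONEMPTY subsets. -/
theorem sum_lt_of_neg (j : ι) (hneg : ∀ i, g i < 0) (hmax : ∀ i, i ≠ j → g i < g j)
    (S : Finset ι) (hS : S.Nonempty) (hSj : S ≠ {j}) : ∑ i ∈ S, g i < g j := by
  obtain ⟨i, hi⟩ := hS
  have hgi : g i ≤ g j := by
    rcases eq_or_ne i j with rfl | h
    · exact le_rfl
    · exact (hmax i h).le
  by_cases h : S = {i}
  · subst h
    have hij : i ≠ j := fun h => hSj (by rw [h])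
    simpa using hmax i hij
  · -- `S` has a second element, so the rest of the sum is negative
    have hne : (S.erase i).Nonempty := by
      by_contra hc
      rw [Finset.not_nonempty_iff_eq_empty, Finset.erase_eq_empty_iff] at hc
      rcases hc with hc | hc
      · rw [hc] at hi; simp at hi
      · exact h hc
    have hrest : ∑ i' ∈ S.erase i, g i' < 0 := Finset.sum_neg (fun i' _ => hneg i') hne
    have := Finset.add_sum_erase S g hi
    omega

/-- If `g > 0` everywhere with a strict unique minimum at `j`, then `univ.erase j` is the unique strict
maximiser of `S ↦ Σ_S g` among PROPER subsets. -/
theorem sum_lt_sum_erase_of_pos (j : ι) (hpos : ∀ i, 0 < g i) (hmin : ∀ i, i ≠ j → g j < g i)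
    (S : Finset ι) (hS : S ≠ Finset.univ) (hSj : S ≠ Finset.univ.erase j) :
    ∑ i ∈ S, g i < ∑ i ∈ Finset.univ.erase j, g i := by
  have hc : Sᶜ.Nonempty := by
    rw [Finset.nonempty_iff_ne_empty, Ne, Finset.compl_eq_empty_iff]
    exact hS
  have hcj : Sᶜ ≠ {j} := by
    intro h
    apply hSj
    have := congrArg (fun T : Finset ι => Tᶜ) h
    simp only [compl_compl] at this
    rw [this, ← Finset.compl_singleton]
  have key := sum_lt_of_neg (fun i => - g i) j (fun i => by simpa using hpos i)
    (fun i hi => by simpa using hmin i hi) Sᶜ hc hcj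
  have h1 := Finset.sum_add_sum_compl S g
  have h2 := Finset.sum_erase_add Finset.univ g (Finset.mem_univ j)
  simp only [Finset.sum_neg_distrib] at key
  omega

end SetFun

end Summit.ValiantsHypothesis.ValiantsHypothesis.Theorems.DissociatedFixedK.Negative
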